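import Summits.ResolutionOfSingularities.ResolutionOfSingularities.Theorems.EquisingularLiftEquisingularLiftNatF102PullbackSheafHomFrames
import Literature.AlgebraicGeometry.Modules.VectorBundleFiniteLocallyFree
import HarnessLib

/-!
# [OURS · L1 W4.5(b) · LINE (T-j)-PROOF support, brick (β)] Pull-back commutes with the internal Hom of finite locally free modules:
# `i^*𝓗om(M, N) ≅ 𝓗om(i^*M, i^*N)`

Cell res-hironaka, LADDER-RESOLUTION rung L, slot W4.5(b), crux chain w45b: EL♮(3) = stmt-ResolutionOfSingularities-20148, residue (T-j) = F-102
(LINE (T-j)-PROOF brick B4 (γ*), sub-brick (β)/(β₁): res-L1-w45b-plan-1 22:11:34Z / 22:38:49Z; Ψ-route of res-L1-w45b-lead-2). Seat res-D-pv-036 g11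
(on-call supplier). `--supports stmt-ResolutionOfSingularities-20148 --as helper`. NOT a statement of any manuscript; OURS; AI-written, weaker than
expert review. Definition-free; standard axioms.

* `nonempty_pullback_sheafHom_iso` — for `g : Y ⟶ X` and FINITE LOCALLY FREE `M`, `N` on `X` (`Motives.IsFiniteLocallyFree`):
  `Nonempty ((pullback g).obj (sheafHom M N) ≅ sheafHom ((pullback g).obj M) ((pullback g).obj N))` — the framed-cover theorem
  `F102.nonempty_pullback_sheafHom_iso_of_frames` (…NatF102PullbackSheafHomFrames) on the cover `x ↦ U_x ∩ U′_x` of common trivialising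
  neighbourhoods (Mathlib `SheafOfModules.restrictTrivialisation`, as in the tree's `isFiniteLocallyFree_sheafHom′`).
* `nonempty_pullback_sheafHom_iso_of_isVectorBundle` — the same from `Motives.IsVectorBundle` (tree `IsVectorBundle.isFiniteLocallyFree`); in
  particular for two LINE BUNDLES ((β₁)), e.g. the ideal sheaves of the two sections of the F-102 curve.
[cite: Hartshorne1977, II Ex. 5.1, II Ex. 5.18] [folklore]
-/

noncomputable section

open CategoryTheory AlgebraicGeometry Opposite TopologicalSpace
open Literature.AlgebraicGeometry.Modules Literature.AlgebraicGeometry.Motives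

set_option linter.dupNamespace false

namespace Summit.ResolutionOfSingularities.ResolutionOfSingularities.Cruxes.EquisingularLiftNat.F102

universe u

variable {X Y : Scheme.{u}} (g : Y ⟶ X)

/-- **(β) `i^*𝓗om(M, N) ≅ 𝓗om(i^*M, i^*N)` for finite locally free `M`, `N`** (common trivialising neighbourhoods `U_x ∩ U′_x`, then the
framed-cover theorem). [cite: Hartshorne1977, II Ex. 5.1, II Ex. 5.18] [folklore] -/
theorem nonempty_pullback_sheafHom_iso {M N : X.Modules} (hM : IsFiniteLocallyFree M) (hN : IsFiniteLocallyFree N) :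
    Nonempty ((Scheme.Modules.pullback g).obj (sheafHom M N) ≅
      sheafHom ((Scheme.Modules.pullback g).obj M) ((Scheme.Modules.pullback g).obj N)) := by
  classical
  choose U hxU J hJ eM using hM
  choose U' hxU' K hK eN using hN
  haveI : ∀ x, Fintype (J x) := fun x => @Fintype.ofFinite _ (hJ x)
  haveI : ∀ x, Fintype (K x) := fun x => @Fintype.ofFinite _ (hK x)
  have hcov : iSup (fun x : X => U x ⊓ U' x) = ⊤ :=
    eq_top_iff.mpr fun x _ => Opens.mem_iSup.mpr ⟨x, hxU x, hxU' x⟩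
  exact nonempty_pullback_sheafHom_iso_of_frames g (fun x : X => U x ⊓ U' x) hcov
    (fun x => SheafOfModules.restrictTrivialisation (R := X.ringCatSheaf) (homOfLE inf_le_left) (eM x).some)
    (fun x => SheafOfModules.restrictTrivialisation (R := X.ringCatSheaf) (homOfLE inf_le_right) (eN x).some)

/-- **(β) for vector bundles** (`Motives.IsVectorBundle`), in particular two LINE BUNDLES ((β₁)). [cite: Hartshorne1977, II Ex. 5.1] [folklore] -/
theorem nonempty_pullback_sheafHom_iso_of_isVectorBundle {M N : X.Modules} (hM : IsVectorBundle M) (hN : IsVectorBundle N) :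
    Nonempty ((Scheme.Modules.pullback g).obj (sheafHom M N) ≅
      sheafHom ((Scheme.Modules.pullback g).obj M) ((Scheme.Modules.pullback g).obj N)) :=
  nonempty_pullback_sheafHom_iso g hM.isFiniteLocallyFree hN.isFiniteLocallyFree

end Summit.ResolutionOfSingularities.ResolutionOfSingularities.Cruxes.EquisingularLiftNat.F102

end
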